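import Literature.NumberTheory.Automorphic.Liu2021.LemD1Item1AtV2OfSplit
import Literature.NumberTheory.GelbartRogawski1991.UndoubledSplittingsUnitary
import Literature.NumberTheory.Automorphic.Liu2021.LemD1AsPrintedIndexedNonVacuityAtPlace
import HarnessLib

/-!
# [Liu2021, App. D Lem. D.1 (1)] at rank `≥ 2` for THE CM `θ`-package: the split places are IN-HOUSE, so the per-place
# letter may be cut to the NON-SPLIT places (the `by_cases` combiner)

Topic `NumberTheory/Automorphic/Liu2021`; namespace `Literature.NumberTheory.Automorphic.Liu2021.Def411WeilCarriers` (sequel of ★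
`LemD1Item1AtV2OfSplit.lean`).  THEOREMS ONLY: no definition, no named fact, no instance, no `sorry`; nothing of [Liu2021] is asserted.

★ `lemD1_1AsPrinted_localLemD1DataAtV₂_of_not_isField` (B-p04 (g30), p830397) proves [Liu2021, Lemma D.1, first sentence + (1)] AS
PRINTED on the rank-`≥ 2` datum ★ `localLemD1DataAtV₂ … a 𝓢 … χ v` at a place `v` with `E_v` NOT a field, for ANY family `𝓢` of local
splittings, under two side conditions: a Borel structure + Haar measure `μ'` on `F_v`, and the UNITARITY `hL2 : (𝓢.omegaLoc v).IsL2Isometric (μ'ⁿ)`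
of the local Weil representation.  For THE `θ`-package of the cell — the CM undoubling
`𝓢_θ(a) := congrW … (undoubledSplittings … θ 𝔪 (cmFinLocalFamily … θ hθ 𝔪)) …` at the line `⟨a⟩` — both are in the tree: the Borel
σ-algebra and Mathlib's `Measure.addHaar` on `L⁺_v` (as in ★ `borelPlaceMeasure`), and ★
`GRConstruction.isL2Isometric_omegaLoc_congrW_undoubledSplittings_cmFinLocalFamily` (`θ` unitary).  Hence:

* **`lemD1_1AsPrinted_localLemD1DataAtV₂_cmFinLocalFamily_of_split`** — at a place `v` of `L⁺` SPLIT in `L` (a place `w ∣ v` with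
  `c̄ • w ≠ w`; ★ `LemD1IndexedNonVacuityAtPlace.not_isField_localRing_of_split`), Lemma D.1 (1) AS PRINTED holds for the CM `θ`-package
  datum with NO further hypothesis (every rank `n ≥ 2`, Step 2's `μ_v` the caller's);
* **`lemD1_1AsPrinted_localLemD1DataAtV₂_cmFinLocalFamily_of_forall_nonsplit`** — the COMBINER: the letter «Lemma D.1 (1) AS PRINTED at every
  NON-SPLIT place» (`∀ v, (∀ w : PlacesOver L v, c̄ • w = w) → LemD1_1AsPrinted (… v)`) implies the all-places form `∀ v, LemD1_1AsPrinted (… v)`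
  consumed by ★ `Def411WeilCarriersLocalFactorsGluing` §1 and ★ `Def411WeilCarriersAtChiSplittingGluing.…_of_lemD1_1AsPrinted`.

Cell `hodgecm-mathlib`, P5: this is the one-token cut of the `h1` letter of ★ p830748
`F0P5CurveThetaCompanionRelabelOfLocalFactors.companionRelabelTransfer₂_of_nonsplit_lemD1_4` to the non-split places (desk word 17:58:29Z (1),
«a later edition»).  HC_CM is proved only modulo the printed citations until rung 0 closes; this file proves no cell binder and books no letter.

## References
* [Liu2021] Y. Liu, Camb. J. Math. 9 (2021) = arXiv:2102.11518: App. D §D.1 Steps 1–3 (l. 5217–5221), Lemma D.1 (1) (l. 5226–5229,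
  p. 125–126), proof (split case) l. 5241 ∕ 5253 (p. 126).
* [GelbartRogawski1991] S. Gelbart, J. Rogawski, Invent. Math. 105 (1991), §3.1 Prop. 3.1.1 p. 455 L1–3.
* [CasselsFrohlichANT1967] J. W. S. Cassels, A. Fröhlich (eds.), *Algebraic Number Theory* (1967), Ch. II §10.
-/

set_option autoImplicit false

noncomputable section

open scoped Matrix Kronecker TensorProduct Classical RestrictedProduct
open NumberField IsDedekindDomain Filter Set
open _root_.MeasureTheory
open Literature.NumberTheory Literature.NumberTheory.Automorphic Literature.NumberTheory.Automorphic.UnitaryGroup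
open Literature.NumberTheory.Weil1964 Literature.RepresentationTheory
open Literature.RepresentationTheory.HeisenbergGroup

namespace Literature.NumberTheory.Automorphic.Liu2021.Def411WeilCarriers

open Literature.NumberTheory.GelbartRogawski1991 Literature.NumberTheory.GelbartRogawski1991.UnitaryDualPair
open Literature.NumberTheory.GelbartRogawski1991.UnitaryDualPair.WeilCoinv
open Literature.NumberTheory.GelbartRogawski1991.GRConstruction
open Literature.NumberTheory.GaloisRepresentations Literature.RepresentationTheory.HarrisKudlaSweet1996
open Literature.NumberTheory.Automorphic.Liu2021.Def411WeilCarriersDoubling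

variable (L : Type) [Field L] [NumberField L] [IsCMField L] {N' n' : ℕ} (e₁ : Fin N' × Fin 1 ≃ Fin n') (dV₁ : Fin N' → L)
/- (every further binder explicit per declaration — no section `variable` carrying a hypothesis, per the gate's D-0026 readout) -/

/-- **[Liu2021, Lem. D.1, first sentence + (1)] AS PRINTED at a SPLIT place, for THE CM `θ`-package, with no further hypothesis**: for `θ` a unitary
splitting character, any family of Haar data `𝔪`, any line `⟨a⟩`, any `χ ∈ Chi`, any rank `n ≥ 2` and Step-2 characters `μ_v` (the caller's), and a
place `v` of `L⁺` under a place `w` of `L` with `c̄ • w ≠ w`: `LemD1_1AsPrinted (localLemD1DataAtV₂ … a 𝓢_θ(a) … χ v)` — ★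
`lemD1_1AsPrinted_localLemD1DataAtV₂_of_not_isField` with `E_v` not a field (★ `not_isField_localRing_of_split`), the Borel σ-algebra and
`Measure.addHaar` on `L⁺_v`, and the unitarity of the CM undoubling (★ `isL2Isometric_omegaLoc_congrW_undoubledSplittings_cmFinLocalFamily`).
[cite: Liu2021, App. D Lemma D.1 (1) (l. 5226–5229), proof l. 5241 (p. 126)] [cite: GelbartRogawski1991, §3.1 Prop. 3.1.1 p. 455 L1–3] -/
theorem lemD1_1AsPrinted_localLemD1DataAtV₂_cmFinLocalFamily_of_split
    (hdV₁ : ∀ i, IsCMField.complexConj L (dV₁ i) = dV₁ i) (hdV₁0 : ∀ i, dV₁ i ≠ 0)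
    (θ : HeckeCharacter L) (hθu : θ.IsUnitary) (hθs : IsSplittingChar L 1 θ) (𝔪 : ∀ v, PlaceMeasure L v)
    (a : (Fp L)ˣ) (χ : Chi (Fp L) L (IsCMField.complexConj L))
    (hn : 2 ≤ n') (μ : ∀ v : HeightOneSpectrum (𝓞 (Fp L)), (LocalRing L v)ˣ →* ℂˣ) (hμn : ∀ v x, ‖((μ v x : ℂˣ) : ℂ)‖ = 1)
    (hμc : ∀ v, Continuous fun x => ((μ v x : ℂˣ) : ℂ))
    (hμF : ∀ (v : HeightOneSpectrum (𝓞 (Fp L))) (t : (v.adicCompletion (Fp L))ˣ),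
      μ v (Units.map (algebraMap (v.adicCompletion (Fp L)) (LocalRing L v)).toMonoidHom t) = 1 ↔
        ∃ x : (LocalRing L v)ˣ, (x : LocalRing L v) * conjLocal L (IsCMField.complexConj L) v x =
          algebraMap (v.adicCompletion (Fp L)) (LocalRing L v) t)
    (v : HeightOneSpectrum (𝓞 (Fp L))) (w : UnitaryGroup.PlacesOver L v) (hw : IsCMField.complexConj L • w.1 ≠ w.1) :
    LemD1_1AsPrinted (localLemD1DataAtV₂ (Fp L) L (IsCMField.complexConj L) N' e₁ (Matrix.diagonal dV₁) (complexConj_imagUnit L)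
      (imagUnit_ne_zero L) (imagUnit_mul_self L) (realDiagonal_isSymm L dV₁ hdV₁) (isUnit_det_realDiagonal L dV₁ hdV₁ hdV₁0)
      (realDiagonal_map L dV₁ hdV₁).symm a
      (congrW L e₁ dV₁ hdV₁ (lineW L (TW (Fp L) a)) (complexConj_lineW L (TW (Fp L) a)) (realDiagonal_lineW L (TW (Fp L) a))
        (diagonal_lineW L (TW (Fp L) a) (JW_eq (Fp L) L a))
        (undoubledSplittings L e₁ dV₁ hdV₁ hdV₁0 (lineW L (TW (Fp L) a)) (complexConj_lineW L (TW (Fp L) a))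
          (lineW_ne_zero L (TW (Fp L) a) (isUnit_det_TW (Fp L) a)) θ 𝔪
          (cmFinLocalFamily L e₁ dV₁ hdV₁ hdV₁0 (lineW L (TW (Fp L) a)) (complexConj_lineW L (TW (Fp L) a))
            (lineW_ne_zero L (TW (Fp L) a) (isUnit_det_TW (Fp L) a)) θ hθs 𝔪))
        (isSymm_TW (Fp L) a) (JW_eq (Fp L) L a))
      hn μ hμn hμc hμF χ v) := by
  letI : MeasurableSpace (v.adicCompletion (Fp L)) := borel _
  haveI : BorelSpace (v.adicCompletion (Fp L)) := ⟨rfl⟩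
  exact lemD1_1AsPrinted_localLemD1DataAtV₂_of_not_isField (Fp L) L (IsCMField.complexConj L) N' e₁ (Matrix.diagonal dV₁)
    (complexConj_imagUnit L) (imagUnit_ne_zero L) (imagUnit_mul_self L) (realDiagonal_isSymm L dV₁ hdV₁)
    (isUnit_det_realDiagonal L dV₁ hdV₁ hdV₁0) (realDiagonal_map L dV₁ hdV₁).symm a _ hn μ hμn hμc hμF χ v
    (LemD1IndexedNonVacuityAtPlace.not_isField_localRing_of_split L v (IsCMField.complexConj L) w hw)
    Measure.addHaar
    (isL2Isometric_omegaLoc_congrW_undoubledSplittings_cmFinLocalFamily L e₁ dV₁ hdV₁ hdV₁0 (lineW L (TW (Fp L) a))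
      (complexConj_lineW L (TW (Fp L) a)) (lineW_ne_zero L (TW (Fp L) a) (isUnit_det_TW (Fp L) a)) θ hθs 𝔪 v hθu
      (realDiagonal_lineW L (TW (Fp L) a)) (diagonal_lineW L (TW (Fp L) a) (JW_eq (Fp L) L a)) (isSymm_TW (Fp L) a)
      (JW_eq (Fp L) L a) Measure.addHaar)

/-- **The COMBINER: Lemma D.1 (1) AS PRINTED at the NON-SPLIT places ⇒ at EVERY place, for THE CM `θ`-package** (`by_cases` on
«every place `w ∣ v` of `L` is `c̄`-fixed»: the non-split places are the letter's, the split ones are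
`lemD1_1AsPrinted_localLemD1DataAtV₂_cmFinLocalFamily_of_split`).  This is the shape ★ `Def411WeilCarriersLocalFactorsGluing` §1 and ★
`Def411WeilCarriersAtChiSplittingGluing.exists_equiv_rhoVAtLine_of_forall_areIsomorphicRep_localFactor_of_lemD1_1AsPrinted` consume (`hD1 : ∀ v, …`), so the
cell's letter «[Liu2021, Lem. D.1 (1)] for the companion package» may be typed at the NON-SPLIT places only.
[cite: Liu2021, App. D Lemma D.1 (1) (l. 5226–5229, p. 125–126)] [cite: CasselsFrohlichANT1967, Ch. II §10] -/
theorem lemD1_1AsPrinted_localLemD1DataAtV₂_cmFinLocalFamily_of_forall_nonsplit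
    (hdV₁ : ∀ i, IsCMField.complexConj L (dV₁ i) = dV₁ i) (hdV₁0 : ∀ i, dV₁ i ≠ 0)
    (θ : HeckeCharacter L) (hθu : θ.IsUnitary) (hθs : IsSplittingChar L 1 θ) (𝔪 : ∀ v, PlaceMeasure L v)
    (a : (Fp L)ˣ) (χ : Chi (Fp L) L (IsCMField.complexConj L))
    (hn : 2 ≤ n') (μ : ∀ v : HeightOneSpectrum (𝓞 (Fp L)), (LocalRing L v)ˣ →* ℂˣ) (hμn : ∀ v x, ‖((μ v x : ℂˣ) : ℂ)‖ = 1)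
    (hμc : ∀ v, Continuous fun x => ((μ v x : ℂˣ) : ℂ))
    (hμF : ∀ (v : HeightOneSpectrum (𝓞 (Fp L))) (t : (v.adicCompletion (Fp L))ˣ),
      μ v (Units.map (algebraMap (v.adicCompletion (Fp L)) (LocalRing L v)).toMonoidHom t) = 1 ↔
        ∃ x : (LocalRing L v)ˣ, (x : LocalRing L v) * conjLocal L (IsCMField.complexConj L) v x =
          algebraMap (v.adicCompletion (Fp L)) (LocalRing L v) t)
    (hD1 : ∀ v : HeightOneSpectrum (𝓞 (Fp L)),
      (∀ w : UnitaryGroup.PlacesOver L v, IsCMField.complexConj L • w.1 = w.1) →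
      LemD1_1AsPrinted (localLemD1DataAtV₂ (Fp L) L (IsCMField.complexConj L) N' e₁ (Matrix.diagonal dV₁) (complexConj_imagUnit L)
        (imagUnit_ne_zero L) (imagUnit_mul_self L) (realDiagonal_isSymm L dV₁ hdV₁) (isUnit_det_realDiagonal L dV₁ hdV₁ hdV₁0)
        (realDiagonal_map L dV₁ hdV₁).symm a
        (congrW L e₁ dV₁ hdV₁ (lineW L (TW (Fp L) a)) (complexConj_lineW L (TW (Fp L) a)) (realDiagonal_lineW L (TW (Fp L) a))
          (diagonal_lineW L (TW (Fp L) a) (JW_eq (Fp L) L a))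
          (undoubledSplittings L e₁ dV₁ hdV₁ hdV₁0 (lineW L (TW (Fp L) a)) (complexConj_lineW L (TW (Fp L) a))
            (lineW_ne_zero L (TW (Fp L) a) (isUnit_det_TW (Fp L) a)) θ 𝔪
            (cmFinLocalFamily L e₁ dV₁ hdV₁ hdV₁0 (lineW L (TW (Fp L) a)) (complexConj_lineW L (TW (Fp L) a))
              (lineW_ne_zero L (TW (Fp L) a) (isUnit_det_TW (Fp L) a)) θ hθs 𝔪))
          (isSymm_TW (Fp L) a) (JW_eq (Fp L) L a))
        hn μ hμn hμc hμF χ v))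
    (v : HeightOneSpectrum (𝓞 (Fp L))) :
    LemD1_1AsPrinted (localLemD1DataAtV₂ (Fp L) L (IsCMField.complexConj L) N' e₁ (Matrix.diagonal dV₁) (complexConj_imagUnit L)
      (imagUnit_ne_zero L) (imagUnit_mul_self L) (realDiagonal_isSymm L dV₁ hdV₁) (isUnit_det_realDiagonal L dV₁ hdV₁ hdV₁0)
      (realDiagonal_map L dV₁ hdV₁).symm a
      (congrW L e₁ dV₁ hdV₁ (lineW L (TW (Fp L) a)) (complexConj_lineW L (TW (Fp L) a)) (realDiagonal_lineW L (TW (Fp L) a))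
        (diagonal_lineW L (TW (Fp L) a) (JW_eq (Fp L) L a))
        (undoubledSplittings L e₁ dV₁ hdV₁ hdV₁0 (lineW L (TW (Fp L) a)) (complexConj_lineW L (TW (Fp L) a))
          (lineW_ne_zero L (TW (Fp L) a) (isUnit_det_TW (Fp L) a)) θ 𝔪
          (cmFinLocalFamily L e₁ dV₁ hdV₁ hdV₁0 (lineW L (TW (Fp L) a)) (complexConj_lineW L (TW (Fp L) a))
            (lineW_ne_zero L (TW (Fp L) a) (isUnit_det_TW (Fp L) a)) θ hθs 𝔪))
        (isSymm_TW (Fp L) a) (JW_eq (Fp L) L a))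
      hn μ hμn hμc hμF χ v) := by
  by_cases h : ∀ w : UnitaryGroup.PlacesOver L v, IsCMField.complexConj L • w.1 = w.1
  · exact hD1 v h
  · obtain ⟨w, hw⟩ := not_forall.1 h
    exact lemD1_1AsPrinted_localLemD1DataAtV₂_cmFinLocalFamily_of_split L e₁ dV₁ hdV₁ hdV₁0 θ hθu hθs 𝔪 a χ hn μ hμn hμc hμF v w hw

end Literature.NumberTheory.Automorphic.Liu2021.Def411WeilCarriers

end
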